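import Mathlib
import Summits.RiemannHypothesis.RiemannHypothesis.Theorems.WeilGroundStateGroundStatesConvergeToXiRHofTight
import Summits.RiemannHypothesis.RiemannHypothesis.Theorems.WeilGroundStateGroundStatesConvergeToXiUniformBoundHalf
import Summits.RiemannHypothesis.RiemannHypothesis.Theorems.WeilGroundStateGroundStatesConvergeToXiStubPointwiseOfWeak
import Summits.RiemannHypothesis.RiemannHypothesis.Theorems.GronwallLeakage.Negative.LoadBearing
import Literature.NumberTheory.LFunctions.WeilGroundState
import HarnessLib

/-!
# Tightness below the polar exponent forces sub-exponential ground energy at the witness windows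
(crux item stmt-RiemannHypothesis-1527 `GroundStatesConvergeToXi`, route
route-RiemannHypothesis-WeilGroundState, line `Sketch`; `--supports`)

Energy-side half of "C⁺ along geometric windows ⇒ RH" (`…RHofTightGeo.lean`):

* `abs_weilGroundEnergy_mul_norm_pairing_le` — the Euler–Lagrange bound at one window,
  `|ε(a)| · |⟨c u, h₀⟩| ≤ C ∫ |c u| e^{|t|/2}`, with the constant of the uniform bound at the polar
  exponent (`norm_weilFunctional_weilConv_weilReflect_le_half`).
* `integral_norm_mul_exp_half_le_of_window` — `∫ |c u| e^{|t|/2} ≤ e^{(1/2-b)a} ∫ |c u| e^{b|t|}`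
  for a ground state at window `a` and `b ≤ 1/2`.
* `neg_exp_le_weilGroundEnergy_of_tight` — tightness in every `L¹(e^{b|t|})`, `b < 1/2`, plus one
  non-degenerate test pairing give `ε(a_k) ≥ -K_δ e^{δ a_k}` for every `δ > 0` AT THE WITNESS
  WINDOWS.
* `neg_exp_le_weilGroundEnergy_of_geometric` — along windows of at most geometric growth
  (`a_{k+1} ≤ A a_k`) monotonicity of `ε` spreads such a bound to ALL windows.
* `neg_exp_le_weilGroundEnergy_of_tightWeakLimit_geometric` — hence a C⁺-witness (tight for
  `b < 1/2`, weakly convergent to `Φ`) along geometric windows makes the ground energy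
  sub-exponential: `∀ δ > 0, ∃ K, ∀ a > 0, -K e^{δ a} ≤ ε(a)` — the hypothesis of
  `riemannHypothesis_of_weilGroundEnergy_subexp` (`…EnergySubexp.lean`).
-/

noncomputable section

set_option linter.dupNamespace false

open scoped Topology Real ComplexConjugate
open Filter Set MeasureTheory Complex

namespace Summit.RiemannHypothesis.RiemannHypothesis.Theorems.GroundStatesConvergeToXi

open Literature.NumberTheory.LFunctions

/-! ## The Euler–Lagrange bound at one window -/

/-- **`|ε(a)| · |⟨c u, h₀⟩| ≤ C ∫ |c u| e^{|t|/2}`** for a ground state `u` at window `a`, any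
scalar `c`, a test function `h₀` supported in the window, and the constant `C` of the uniform
bound `‖W(f ⋆ h̃₀)‖ ≤ C ∫|f|e^{|t|/2}` (`norm_weilFunctional_weilConv_weilReflect_le_half`): pass
to the limit in the weak Euler–Lagrange equation `W(gₙ ⋆ h̃₀) → ε(a)⟨u, h₀⟩` along the
minimising sequence (`groundState_eulerLagrange`, `tendsto_integral_norm_mul_exp_of_minimizingSeq`).
[folklore] -/
theorem abs_weilGroundEnergy_mul_norm_pairing_le {a : ℝ} {u : ℝ → ℂ}
    (hu : IsWeilGroundState a u) (c : ℂ) {h₀ : ℝ → ℂ} (hh₀ : IsWeilTest h₀)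
    (hsupp : tsupport h₀ ⊆ Icc (-a) a) {C : ℝ}
    (hC : ∀ f : ℝ → ℂ, IsWeilTest f →
      ‖weilFunctional (weilConv f (weilReflect h₀))‖ ≤ C * ∫ t, ‖f t‖ * Real.exp (1 / 2 * |t|)) :
    |weilGroundEnergy a| * ‖∫ t, c * u t * conj (h₀ t)‖ ≤
      C * ∫ t, ‖c * u t‖ * Real.exp (1 / 2 * |t|) := by
  obtain ⟨hu2, g, hg, hQ, hL⟩ := hu
  have hEL := groundState_eulerLagrange hg hQ hu2 hL hh₀ hsupp
  have hW := tendsto_integral_norm_mul_exp_of_minimizingSeq ⟨hu2, g, hg, hQ, hL⟩ hg hL (1 / 2)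
  have h1 : ‖(weilGroundEnergy a : ℂ) * ∫ t, u t * conj (h₀ t)‖ ≤
      C * ∫ t, ‖u t‖ * Real.exp (1 / 2 * |t|) :=
    le_of_tendsto_of_tendsto' hEL.norm (hW.const_mul C) fun n => hC (g n) (hg n).1
  have h2 : ‖c‖ * (C * ∫ t, ‖u t‖ * Real.exp (1 / 2 * |t|)) =
      C * ∫ t, ‖c * u t‖ * Real.exp (1 / 2 * |t|) := by
    rw [← integral_const_mul, ← integral_const_mul, ← integral_const_mul]
    congr 1 with t
    rw [norm_mul]
    ring
  have h3 : ‖c‖ * ‖(weilGroundEnergy a : ℂ) * ∫ t, u t * conj (h₀ t)‖ =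
      |weilGroundEnergy a| * ‖∫ t, c * u t * conj (h₀ t)‖ := by
    have hfun : (fun t => c * u t * conj (h₀ t)) = fun t => c * (u t * conj (h₀ t)) := by
      funext t; ring
    rw [hfun, integral_const_mul, norm_mul, norm_mul, Complex.norm_real, Real.norm_eq_abs]
    ring
  calc |weilGroundEnergy a| * ‖∫ t, c * u t * conj (h₀ t)‖
      = ‖c‖ * ‖(weilGroundEnergy a : ℂ) * ∫ t, u t * conj (h₀ t)‖ := h3.symm
    _ ≤ ‖c‖ * (C * ∫ t, ‖u t‖ * Real.exp (1 / 2 * |t|)) :=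
        mul_le_mul_of_nonneg_left h1 (norm_nonneg _)
    _ = C * ∫ t, ‖c * u t‖ * Real.exp (1 / 2 * |t|) := h2

/-- **Polar integral from tightness below the polar exponent, on a window**: for a ground state
`u` at window `a` and `b ≤ 1/2`, `∫ |c u| e^{|t|/2} ≤ e^{(1/2 - b) a} ∫ |c u| e^{b|t|}` (`u`
vanishes a.e. off `[-a, a]`, where `e^{|t|/2} = e^{(1/2-b)|t|} e^{b|t|} ≤ e^{(1/2-b)a} e^{b|t|}`).
[folklore] -/
theorem integral_norm_mul_exp_half_le_of_window {a : ℝ} {u : ℝ → ℂ} (hu : IsWeilGroundState a u)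
    (c : ℂ) {b : ℝ} (hb : b ≤ 1 / 2) :
    ∫ t, ‖c * u t‖ * Real.exp (1 / 2 * |t|) ≤
      Real.exp ((1 / 2 - b) * a) * ∫ t, ‖c * u t‖ * Real.exp (b * |t|) := by
  rw [← integral_const_mul]
  refine integral_mono_ae (stub_pointwise_of_weak_integrable_weight hu c (1 / 2))
    ((stub_pointwise_of_weak_integrable_weight hu c b).const_mul _) ?_
  filter_upwards [hu.ae_eq_zero_of_notMem] with t ht
  by_cases hmem : t ∈ Icc (-a) a
  · have hta : |t| ≤ a := abs_le.2 ⟨by linarith [hmem.1], hmem.2⟩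
    have hexp : Real.exp (1 / 2 * |t|) ≤ Real.exp ((1 / 2 - b) * a) * Real.exp (b * |t|) := by
      rw [← Real.exp_add]
      exact Real.exp_le_exp.2 (by nlinarith [abs_nonneg t])
    calc ‖c * u t‖ * Real.exp (1 / 2 * |t|)
        ≤ ‖c * u t‖ * (Real.exp ((1 / 2 - b) * a) * Real.exp (b * |t|)) :=
          mul_le_mul_of_nonneg_left hexp (norm_nonneg _)
      _ = Real.exp ((1 / 2 - b) * a) * (‖c * u t‖ * Real.exp (b * |t|)) := by ring
  · rw [ht hmem, mul_zero, norm_zero, zero_mul, zero_mul, mul_zero]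

/-! ## The exponential lower bound at the witness windows -/

/-- **Tightness below `1/2` + one non-degenerate pairing ⇒ `ε(a_k) ≥ -K_δ e^{δ a_k}`.**  For
ground states `u_k` at windows `a_k`, scalars `c_k` tight in every `L¹(e^{b|t|})`, `b < 1/2`,
and a test function `h₀` supported in all the windows with `‖⟨c_k u_k, h₀⟩‖ ≥ η > 0`: for every
`δ > 0` there is `K ≥ 0` with `-K e^{δ a_k} ≤ ε(a_k)` for all `k` (take `b = max (1/2 - δ) 0`:
`|ε(a_k)| η ≤ C e^{(1/2-b) a_k} M_b`). -/
theorem neg_exp_le_weilGroundEnergy_of_tight {a : ℕ → ℝ} {u : ℕ → ℝ → ℂ} {c : ℕ → ℂ}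
    (hu : ∀ k, IsWeilGroundState (a k) (u k))
    (htight : ∀ b : ℝ, b < 1 / 2 → ∃ M : ℝ, ∀ k, ∫ t, ‖c k * u k t‖ * Real.exp (b * |t|) ≤ M)
    {h₀ : ℝ → ℂ} (hh₀ : IsWeilTest h₀) (hsupp : ∀ k, tsupport h₀ ⊆ Icc (-(a k)) (a k))
    {η : ℝ} (hη : 0 < η) (hηk : ∀ k, η ≤ ‖∫ t, c k * u k t * conj (h₀ t)‖)
    {δ : ℝ} (hδ : 0 < δ) :
    ∃ K : ℝ, 0 ≤ K ∧ ∀ k, -(K * Real.exp (δ * a k)) ≤ weilGroundEnergy (a k) := by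
  obtain ⟨C, hC0, hC⟩ := norm_weilFunctional_weilConv_weilReflect_le_half hh₀
  set b : ℝ := max (1 / 2 - δ) 0 with hb
  have hb1 : b < 1 / 2 := max_lt (by linarith) (by norm_num)
  have hb2 : 1 / 2 - b ≤ δ := by
    have := le_max_left (1 / 2 - δ) 0
    linarith
  obtain ⟨M, hM⟩ := htight b hb1
  have hM0 : 0 ≤ M := le_trans (integral_nonneg fun _ => by positivity) (hM 0)
  refine ⟨C * M / η, by positivity, fun k => ?_⟩
  have hak : 0 < a k := (hu k).pos
  have key : |weilGroundEnergy (a k)| * η ≤ C * M * Real.exp (δ * a k) := by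
    calc |weilGroundEnergy (a k)| * η
        ≤ |weilGroundEnergy (a k)| * ‖∫ t, c k * u k t * conj (h₀ t)‖ :=
          mul_le_mul_of_nonneg_left (hηk k) (abs_nonneg _)
      _ ≤ C * ∫ t, ‖c k * u k t‖ * Real.exp (1 / 2 * |t|) :=
          abs_weilGroundEnergy_mul_norm_pairing_le (hu k) (c k) hh₀ (hsupp k) hC
      _ ≤ C * (Real.exp ((1 / 2 - b) * a k) * ∫ t, ‖c k * u k t‖ * Real.exp (b * |t|)) :=
          mul_le_mul_of_nonneg_left
            (integral_norm_mul_exp_half_le_of_window (hu k) (c k) hb1.le) hC0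
      _ ≤ C * (Real.exp (δ * a k) * M) := by
          refine mul_le_mul_of_nonneg_left (mul_le_mul (Real.exp_le_exp.2 ?_) (hM k)
            (integral_nonneg fun _ => by positivity) (Real.exp_pos _).le) hC0
          exact mul_le_mul_of_nonneg_right hb2 hak.le
      _ = C * M * Real.exp (δ * a k) := by ring
  have : |weilGroundEnergy (a k)| ≤ C * M / η * Real.exp (δ * a k) := by
    rw [div_mul_eq_mul_div, le_div_iff₀ hη]
    exact key
  linarith [neg_abs_le (weilGroundEnergy (a k))]

/-! ## Spreading the bound by monotonicity along geometric windows -/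

/-- **From the witness windows to all windows.**  If `0 < a_k → ∞`, `a_{k+1} ≤ A a_k`, and
`-K e^{δ a_k} ≤ ε(a_k)` for all `k` (`K, δ ≥ 0`), then `-K e^{δ a_0} e^{max A 1 · δ · a} ≤ ε(a)`
for every `a > 0`: `ε` is non-increasing (`weilGroundEnergy_antitone_of_pos`); for `a ≤ a_0` use
the window `a_0`, otherwise the least `a_k ≥ a`, which satisfies `a_k ≤ A a_{k-1} < A a`.
[folklore] -/
theorem neg_exp_le_weilGroundEnergy_of_geometric {a : ℕ → ℝ} (ha : Tendsto a atTop atTop)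
    (hpos : ∀ k, 0 < a k) {A : ℝ} (hA : ∀ k, a (k + 1) ≤ A * a k) {K δ : ℝ} (hK : 0 ≤ K)
    (hδ : 0 ≤ δ) (hε : ∀ k, -(K * Real.exp (δ * a k)) ≤ weilGroundEnergy (a k)) {x : ℝ}
    (hx : 0 < x) :
    -(K * Real.exp (δ * a 0) * Real.exp (max A 1 * δ * x)) ≤ weilGroundEnergy x := by
  classical
  have hex : ∃ k, x ≤ a k := (ha.eventually (eventually_ge_atTop x)).exists
  set k₀ := Nat.find hex with hk₀
  have hk₀spec : x ≤ a k₀ := Nat.find_spec hex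
  have hmono : weilGroundEnergy (a k₀) ≤ weilGroundEnergy x :=
    Summit.RiemannHypothesis.Cruxes.GronwallLeakage.Negative.weilGroundEnergy_antitone_of_pos hx
      hk₀spec
  have h1 : 1 ≤ Real.exp (max A 1 * δ * x) :=
    Real.one_le_exp (by positivity)
  have hE0 : 0 ≤ K * Real.exp (δ * a 0) := by positivity
  rcases Nat.eq_zero_or_pos k₀ with h0 | hkpos
  · -- `x ≤ a 0`
    rw [h0] at hmono
    have := hε 0
    nlinarith
  · -- `a (k₀ - 1) < x ≤ a k₀ ≤ A a (k₀ - 1) < A x`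
    obtain ⟨m, hm⟩ : ∃ m, k₀ = m + 1 := ⟨k₀ - 1, by omega⟩
    rw [hm] at hmono
    have hlt : a m < x := by
      have := Nat.find_min hex (show m < Nat.find hex by rw [← hk₀]; omega)
      exact lt_of_not_ge this
    have hle : a (m + 1) ≤ max A 1 * x := by
      have hAm : A * a m ≤ max A 1 * a m :=
        mul_le_mul_of_nonneg_right (le_max_left _ _) (hpos m).le
      have : max A 1 * a m ≤ max A 1 * x :=
        mul_le_mul_of_nonneg_left hlt.le (le_trans zero_le_one (le_max_right _ _))
      linarith [hA m]
    have hexp : Real.exp (δ * a (m + 1)) ≤ Real.exp (δ * a 0) * Real.exp (max A 1 * δ * x) := by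
      rw [← Real.exp_add]
      refine Real.exp_le_exp.2 ?_
      have : δ * a (m + 1) ≤ δ * (max A 1 * x) := mul_le_mul_of_nonneg_left hle hδ
      nlinarith [hpos 0]
    have := hε (m + 1)
    nlinarith

/-! ## Sub-exponential ground energy from a C⁺-witness along geometric windows -/

/-- **A C⁺-witness along geometric windows makes the ground energy sub-exponential.**  Ground
states `u_k` at windows `a_k → ∞` with `a_{k+1} ≤ A a_k`, scalars `c_k` tight in every
`L¹(e^{b|t|})`, `b < 1/2`, and weak convergence of `c_k u_k` to `Φ = 2Ψ(2·)` against test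
functions give: for every `δ > 0` there is `K` with `-K e^{δ a} ≤ ε(a)` for all `a > 0`.
(A real bump `h₀` at `0` has `∫ Φ h₀ ≠ 0`; on a tail of the sequence — still geometric, with
`supp h₀` inside the windows — the pairings are `≥ ‖∫Φh₀‖/2`; then
`neg_exp_le_weilGroundEnergy_of_tight` and `…_of_geometric` with `δ/max A 1`.) -/
theorem neg_exp_le_weilGroundEnergy_of_tightWeakLimit_geometric {a : ℕ → ℝ} {u : ℕ → ℝ → ℂ}
    {c : ℕ → ℂ} (ha : Tendsto a atTop atTop) {A : ℝ} (hA : ∀ k, a (k + 1) ≤ A * a k)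
    (hu : ∀ k, IsWeilGroundState (a k) (u k))
    (htight : ∀ b : ℝ, b < 1 / 2 → ∃ M : ℝ, ∀ k, ∫ t, ‖c k * u k t‖ * Real.exp (b * |t|) ≤ M)
    (hweak : ∀ g : ℝ → ℂ, IsWeilTest g →
      Tendsto (fun k => ∫ t, c k * u k t * g t) atTop
        (𝓝 (∫ t, 2 * LagariasMontague.Psic (2 * t) * g t)))
    {δ : ℝ} (hδ : 0 < δ) :
    ∃ K : ℝ, ∀ x : ℝ, 0 < x → -(K * Real.exp (δ * x)) ≤ weilGroundEnergy x := by
  obtain ⟨h₀, hh₀, hreal, hP⟩ := exists_isWeilTest_integral_phi_mul_ne_zero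
  -- radius of the bump
  obtain ⟨r, hr⟩ : ∃ r : ℝ, tsupport h₀ ⊆ Icc (-r) r := by
    obtain ⟨R, hR⟩ := hh₀.2.isCompact.isBounded.subset_closedBall 0
    refine ⟨R, fun t ht => ?_⟩
    have := hR ht
    rw [Metric.mem_closedBall, dist_zero_right, Real.norm_eq_abs] at this
    exact ⟨by linarith [neg_abs_le t], le_abs_self t |>.trans this⟩
  -- non-degeneracy on a tail
  set P : ℂ := ∫ t, 2 * LagariasMontague.Psic (2 * t) * h₀ t with hPdef
  have hPpos : 0 < ‖P‖ / 2 := by positivity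
  have hev₁ : ∀ᶠ k in atTop, ‖P‖ / 2 ≤ ‖∫ t, c k * u k t * conj (h₀ t)‖ := by
    have h1 := hweak h₀ hh₀
    rw [Metric.tendsto_nhds] at h1
    filter_upwards [h1 (‖P‖ / 2) hPpos] with k hk
    rw [dist_eq_norm] at hk
    have hconj : (fun t => c k * u k t * conj (h₀ t)) = fun t => c k * u k t * h₀ t := by
      funext t; rw [hreal t]
    rw [hconj]
    have := norm_sub_norm_le P (∫ t, c k * u k t * h₀ t)
    rw [← norm_neg, neg_sub] at hk
    linarith
  have hev₂ : ∀ᶠ k in atTop, r ≤ a k := ha.eventually (eventually_ge_atTop r)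
  obtain ⟨K₀, hK₀⟩ := eventually_atTop.1 (hev₁.and hev₂)
  -- the tail `k ↦ k + K₀` is still geometric and carries `supp h₀`
  have ha' : Tendsto (fun k => a (k + K₀)) atTop atTop := ha.comp (tendsto_add_atTop_nat K₀)
  have hA' : ∀ k, a (k + 1 + K₀) ≤ A * a (k + K₀) := fun k => by
    simpa [Nat.add_right_comm] using hA (k + K₀)
  have htight' : ∀ b : ℝ, b < 1 / 2 →
      ∃ M : ℝ, ∀ k, ∫ t, ‖c (k + K₀) * u (k + K₀) t‖ * Real.exp (b * |t|) ≤ M := fun b hb => by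
    obtain ⟨M, hM⟩ := htight b hb
    exact ⟨M, fun k => hM (k + K₀)⟩
  have hsupp' : ∀ k, tsupport h₀ ⊆ Icc (-(a (k + K₀))) (a (k + K₀)) := fun k => by
    have hrk : r ≤ a (k + K₀) := (hK₀ (k + K₀) (Nat.le_add_left K₀ k)).2
    exact hr.trans (Icc_subset_Icc (neg_le_neg hrk) hrk)
  have hA1 : 0 < max A 1 := lt_of_lt_of_le zero_lt_one (le_max_right _ _)
  set δ' : ℝ := δ / max A 1 with hδ'
  have hδ'0 : 0 < δ' := div_pos hδ hA1
  obtain ⟨K, hK0, hK⟩ := neg_exp_le_weilGroundEnergy_of_tight (a := fun k => a (k + K₀))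
    (fun k => hu (k + K₀)) htight' hh₀ hsupp' hPpos
    (fun k => (hK₀ (k + K₀) (Nat.le_add_left K₀ k)).1) hδ'0
  refine ⟨K * Real.exp (δ' * a (0 + K₀)), fun x hx => ?_⟩
  have h := neg_exp_le_weilGroundEnergy_of_geometric (a := fun k => a (k + K₀)) ha'
    (fun k => (hu (k + K₀)).pos) (A := A) hA' hK0 hδ'0.le hK hx
  have e : max A 1 * δ' * x = δ * x := by
    rw [hδ']
    field_simp
  rwa [e] at h

end Summit.RiemannHypothesis.RiemannHypothesis.Theorems.GroundStatesConvergeToXi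

end
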